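import Summits.CriticalPhenomena.CardyFormulaZ2.Theses.CardyBoundaryCoulombGas
import Summits.CriticalPhenomena.CardyFormulaZ2.Theorems.CardyBoundaryCoulombGasStripClusterRatesBetheKernelToolkit
import Summits.CriticalPhenomena.CardyFormulaZ2.Theorems.CardyBoundaryCoulombGasStripClusterRatesBetheMapInjOn
import Summits.CriticalPhenomena.CardyFormulaZ2.Theorems.CardyBoundaryCoulombGasStripClusterRatesBetheGapLower

/-!
# Local gap upper bound for consecutive Bethe roots
# (line `two-cluster-rate-is-stationary-gap`, crux `StripClusterRates`, stmt-CriticalPhenomena-13878)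

Condensation building block for the Bethe-asymptotics pillar: along every ordered positive solution
`w : Fin M → ℝ` of the ground-state Bethe equations of the open staggered Temperley–Lieb(1) chain,
`N·F(w_j) - ∑_{l ≠ j} [G(w_j - w_l) + G(w_j + w_l)] = π (j+1)`,
`F(w) = arctan((2+√3) tanh w) + arctan(tanh w)`, `G(x) = arctan(tanh x/√3)`,
consecutive roots `j' = j + 1` satisfy the local upper bound
`N·(F(w_{j'}) - F(w_j)) ≤ 4π/3 + 2 (M - 2)/√3 · (w_{j'} - w_j)`.

Proof. Start from the exact gap identity (`bu_gap_identity`)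
`N·(F(w_{j'}) - F(w_j)) = π + 2·G(w_{j'} - w_j)
  + ∑_{l ∉ {j, j'}} ([G(w_{j'} - w_l) - G(w_j - w_l)] + [G(w_{j'} + w_l) - G(w_j + w_l)])`.
Bound `2·G < π/3` (`bk_G_lt`), and each bracket by the Lipschitz bound `G(b) - G(a) ≤ (b - a)/√3` for
`a ≤ b`, which follows from the mean value inequality and the closed form
`G'(x) = (√3/2)/(cosh 2x + 1/2) ≤ (√3/2)/(3/2) = 1/√3` (`bu_hasDerivAt_G`, `Real.one_le_cosh`); in both
brackets the increment of the argument is `w_{j'} - w_j`, so each summand is at most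
`2 (w_{j'} - w_j)/√3`, and the index set `l ∉ {j, j'}` has `M - 2` elements.
-/

noncomputable section

namespace Summit.CriticalPhenomena.CardyFormulaZ2.Cruxes.StripClusterRates.TwoClusterRateIsStationaryGap

open scoped BigOperators

/-- Uniform bound on the scattering kernel: `G'(x) = (√3/2)/(cosh 2x + 1/2) ≤ 1/√3`
(maximum at `x = 0`, since `cosh ≥ 1`). [folklore] -/
theorem bu_kernel_le_inv_sqrt_three (x : ℝ) :
    Real.sqrt 3 / 2 / (Real.cosh (2 * x) + 1 / 2) ≤ 1 / Real.sqrt 3 := by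
  have hcosh : 1 ≤ Real.cosh (2 * x) := Real.one_le_cosh (2 * x)
  have hd : 0 < Real.cosh (2 * x) + 1 / 2 := by linarith
  have hs : 0 < Real.sqrt 3 := Real.sqrt_pos.2 (by norm_num)
  have h3 : Real.sqrt 3 * Real.sqrt 3 = 3 := Real.mul_self_sqrt (by norm_num)
  rw [div_le_div_iff₀ hd hs]
  linarith

/-- Lipschitz bound for the scattering phase: `G(b) - G(a) ≤ (b - a)/√3` for `a ≤ b`
(mean value inequality with `G' ≤ 1/√3`). [folklore] -/
theorem bu_G_sub_le {a b : ℝ} (hab : a ≤ b) :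
    Real.arctan (Real.tanh b / Real.sqrt 3) - Real.arctan (Real.tanh a / Real.sqrt 3) ≤
      (b - a) / Real.sqrt 3 := by
  have hdiff : Differentiable ℝ (fun x : ℝ ↦ Real.arctan (Real.tanh x / Real.sqrt 3)) :=
    fun x => (bu_hasDerivAt_G x).differentiableAt
  have hderiv : ∀ x, deriv (fun x : ℝ ↦ Real.arctan (Real.tanh x / Real.sqrt 3)) x ≤ 1 / Real.sqrt 3 :=
    fun x => by
      rw [(bu_hasDerivAt_G x).deriv]
      exact bu_kernel_le_inv_sqrt_three x
  have h := image_sub_le_mul_sub_of_deriv_le hdiff hderiv hab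
  calc Real.arctan (Real.tanh b / Real.sqrt 3) - Real.arctan (Real.tanh a / Real.sqrt 3)
      ≤ 1 / Real.sqrt 3 * (b - a) := h
    _ = (b - a) / Real.sqrt 3 := by ring

/-- The bracket `G(· - c) + G(· + c)` is `2/√3`-Lipschitz: its increment from `a` to `b ≥ a` is at most
`2 (b - a)/√3`. [folklore] -/
theorem bu_bracket_sub_le {a b : ℝ} (hab : a ≤ b) (c : ℝ) :
    Real.arctan (Real.tanh (b - c) / Real.sqrt 3) - Real.arctan (Real.tanh (a - c) / Real.sqrt 3) +
        (Real.arctan (Real.tanh (b + c) / Real.sqrt 3) - Real.arctan (Real.tanh (a + c) / Real.sqrt 3)) ≤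
      2 * (b - a) / Real.sqrt 3 := by
  have h1 := bu_G_sub_le (show a - c ≤ b - c by linarith)
  have h2 := bu_G_sub_le (show a + c ≤ b + c by linarith)
  have e : (b - c - (a - c)) / Real.sqrt 3 + (b + c - (a + c)) / Real.sqrt 3 = 2 * (b - a) / Real.sqrt 3 := by
    ring
  linarith

/-- **Local gap upper bound** (registered helper of `stmt-CriticalPhenomena-13878`, line
`two-cluster-rate-is-stationary-gap`; condensation step): along every ordered positive solution of the
ground-state Bethe equations of the open staggered TL(1) chain, consecutive roots `j' = j + 1` satisfy
`N·(F(w_{j'}) - F(w_j)) ≤ 4π/3 + 2 (M - 2)/√3 · (w_{j'} - w_j)`. [folklore] -/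
theorem bu_gap_upper_local : ∀ (N M : ℕ) (w : Fin M → ℝ), (StrictMono w ∧ (∀ j, 0 < w j) ∧ ∀ j : Fin M, (N : ℝ) * (Real.arctan ((2 + Real.sqrt 3) * Real.tanh (w j)) + Real.arctan (Real.tanh (w j))) - ∑ l ∈ Finset.univ.erase j, (Real.arctan (Real.tanh (w j - w l) / Real.sqrt 3) + Real.arctan (Real.tanh (w j + w l) / Real.sqrt 3)) = Real.pi * ((j : ℕ) + 1)) → ∀ (j j' : Fin M), (j : ℕ) + 1 = j' → (N : ℝ) * ((Real.arctan ((2 + Real.sqrt 3) * Real.tanh (w j')) + Real.arctan (Real.tanh (w j'))) - (Real.arctan ((2 + Real.sqrt 3) * Real.tanh (w j)) + Real.arctan (Real.tanh (w j)))) ≤ 4 * Real.pi / 3 + 2 * ((M : ℝ) - 2) / Real.sqrt 3 * (w j' - w j) := by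
  rintro N M w ⟨hmono, -, heq⟩ j j' hjj'
  have hne : j ≠ j' := fun h => by rw [h] at hjj'; omega
  have hlt : j < j' := Fin.lt_def.2 (by omega)
  have hw : w j < w j' := hmono hlt
  have h2M : 2 ≤ M := by have := j'.2; omega
  rw [bu_gap_identity heq hjj']
  have hG : Real.arctan (Real.tanh (w j' - w j) / Real.sqrt 3) < Real.pi / 6 := bk_G_lt _
  have hcard : ((Finset.univ.erase j).erase j').card = M - 2 := by
    rw [Finset.card_erase_of_mem (Finset.mem_erase.2 ⟨hne.symm, Finset.mem_univ _⟩),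
      Finset.card_erase_of_mem (Finset.mem_univ _), Finset.card_univ, Fintype.card_fin]
    omega
  have hS : ∑ l ∈ (Finset.univ.erase j).erase j',
      (Real.arctan (Real.tanh (w j' - w l) / Real.sqrt 3) - Real.arctan (Real.tanh (w j - w l) / Real.sqrt 3) +
        (Real.arctan (Real.tanh (w j' + w l) / Real.sqrt 3) -
          Real.arctan (Real.tanh (w j + w l) / Real.sqrt 3))) ≤
      ((M : ℝ) - 2) * (2 * (w j' - w j) / Real.sqrt 3) := by
    refine (Finset.sum_le_sum fun l _ => bu_bracket_sub_le hw.le (w l)).trans ?_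
    rw [Finset.sum_const, hcard, nsmul_eq_mul, Nat.cast_sub h2M, Nat.cast_ofNat]
  have e : ((M : ℝ) - 2) * (2 * (w j' - w j) / Real.sqrt 3) =
      2 * ((M : ℝ) - 2) / Real.sqrt 3 * (w j' - w j) := by ring
  linarith

end Summit.CriticalPhenomena.CardyFormulaZ2.Cruxes.StripClusterRates.TwoClusterRateIsStationaryGap

end
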